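import Literature.Analysis.FluidPDE.KatoMaximalTime
import Literature.Analysis.FluidPDE.RusinSverakWeakStabilityProofs
import HarnessLib

/-!
# Named fact: a finite maximal time forces a singularity at `t = T_max(u₀)`
(Rusin–Šverák 2011, §4 pp. 6–7) — the refinement of `rusin_sverak_singular_point_of_blowup`

Grounder/refinement file (D-0014 named facts) in the DAG below
`Literature.Analysis.FluidPDE.rusin_sverak_minimal_data_compact` (`RusinSverakCompactness.lean`;
Rusin–Šverák, J. Funct. Anal. 260 (2011) 879–891 = arXiv:0911.0500, Cor. 4.3 p. 8, second
clause). After `RusinSverakWeakStabilityProofs.lean` that fact (and the first clause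
`rusin_sverak_minimal_blowup`, `MildSolutions.lean`) is proved from exactly two named facts,

* `N = rusin_sverak_singular_point_of_blowup` (§4 pp. 6–7: "the only reason for `T_max(u₀) < ∞`
  can be a finite time singularity"), and
* `C = rusin_sverak_weak_limit_of_singular_points` (Cor. 4.2).

`N` was transcribed with an anonymous lifespan: "*there are* `T > 0`, `x_*` and a Kato solution
on `[0, T)` singular at `(T, x_*)`". The printed paragraph is about the **maximal** time: "Let us
assume that `T = T_max(u₀)` is finite. [...] If `u` does not develop a singularity at time `T` in
the ball `B_R` [...] `T` was not the maximal time of existence of the mild solution, a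
contradiction." With `T_max(u₀)` now a Literature notion (`katoMaximalTime`,
`KatoMaximalTime.lean`) this file records the paragraph with its own time,

* `rusin_sverak_singularity_at_katoMaximalTime` (**N′**): if `T_max(u₀) < ∞` for a weakly
  divergence-free `Ḣ^{1/2}` datum, then the mild solution on `[0, T_max)` is singular at some
  point `(T_max, x_*)`,

and **proves** `N` from `N′` and Kato's local theory (`kato_local`: `T_max > 0`; `kato_unique`:
the maximal Kato solution on `[0, T_max)` exists by gluing, and `T_max < ∞` for data without a
global Kato solution — `katoMaximalTime_pos`, `exists_isKatoSolutionOn_katoMaximalTime`,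
`katoMaximalTime_eq_top_iff`):
`rusin_sverak_singular_point_of_blowup_of_singularity_at_katoMaximalTime : N′ → kato_local →
kato_unique → N`, whence Cor. 4.3 (both clauses) from `N′`, `C`, `kato_local`, `kato_unique`
(`rusin_sverak_minimal_data_compact_of_singularity_at_katoMaximalTime`,
`rusin_sverak_minimal_blowup_of_singularity_at_katoMaximalTime`).

State of the DAG below `rusin_sverak_minimal_data_compact` after this file: proved modulo
`N′` (Rusin–Šverák §4 pp. 6–7 with Prop. 2.1, Prop. 4.1, Thm. 4.1, (3.14)), `C` (Cor. 4.2),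
and the Kato facts `kato_local`, `kato_unique` (ns.S13, `MildSolutions.lean`).

Transcription notes (those of `RusinSverakWeakStability.lean`, notes (1)–(2), apply verbatim):
the printed `u` is the Leray solution, which on `ℝ³ × [0, T_max(u₀))` *is* the mild solution
(Thm. 4.1), unique in Kato's class (`kato_unique`), so `N′` speaks of any Kato solution on
`[0, T_max)`; "develops a singularity at time `T` (at a point of the ball `B_R`)" is rendered, as
in `N` and in `IsBackwardSingularPoint` (`LocalTypeI.lean`, Albritton–Barker's form of CKN's
singular points), by essential unboundedness on every backward parabolic cylinder
`Q_r(T, x_*) = (T - r², T) × B_r(x_*)` (`parabolicCylinder`), which only involves the solution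
before `T`; for the suitable weak solutions at hand this is equivalent to the failure of
Rusin–Šverák's Hölder regularity at `(x_*, T)` by their Prop. 2.1, the proposition the printed
paragraph invokes. The radius `R` of the printed statement (outside `B_R` the solution is regular
at time `T`, by Prop. 2.1 and the decay of the local energy) is not recorded. Unit viscosity, as
in the paper and in `N`.

Nothing is asserted; users take `(h : rusin_sverak_singularity_at_katoMaximalTime)`.

## References

* W. Rusin, V. Šverák, *Minimal initial data for potential Navier–Stokes singularities*,
  J. Funct. Anal. 260 (2011) 879–891 = arXiv:0911.0500: §3 p. 5 ((3.14), `T_max`), §4 pp. 6–7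
  (Thm. 4.1 and the paragraph following it, Prop. 4.1), Prop. 2.1 (p. 4), Cor. 4.2, Cor. 4.3
  (p. 8).
* T. Kato, Math. Z. 187 (1984) 471–480, Thm. 1, Thm. 4.
* L. Caffarelli, R. Kohn, L. Nirenberg, CPAM 35 (1982), §2, §6 (parabolic cylinders, singular
  points in the `L^∞` form).
-/

noncomputable section

open MeasureTheory TopologicalSpace Set Function Filter Topology
open scoped ENNReal

namespace Literature.Analysis.FluidPDE

local notation "ℝ³" => EuclideanSpace ℝ (Fin 3)
local notation "ℂ³" => EuclideanSpace ℂ (Fin 3)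

/-- NAMED FACT **N′** (Rusin–Šverák, J. Funct. Anal. 260 (2011) = arXiv:0911.0500, §4 pp. 6–7,
the paragraph after Thm. 4.1, with §3 (3.14), Prop. 4.1, Thm. 4.1 and Prop. 2.1: **a finite
maximal time forces a singularity at `t = T_max(u₀)`**). In print: "Proposition 2.1 can be used
to show that the only reason for `T_max(u₀) < ∞` can be a finite time singularity. We will now
sketch a proof of this statement. Let us assume that `T = T_max(u₀)` is finite. [...] for
sufficiently large `R > 0`, the assumptions of Proposition 2.1 are satisfied for our solution
`(u,p)` and `Q_{z₀,r}` with `z₀ = (x₀,T)` and `|x₀| > R`. If `u` does not develop a singularity at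
time `T` in the ball `B_R`, it means that `u` and `∇u` will be bounded in `(t₁,T)` for any
`t₁ > 0`. [...] we see by the energy estimate that `u ∈ L⁴_t Ḣ¹_x(ℝ³ × (0,T))`, which means that
`T` was not the maximal time of existence of the mild solution, a contradiction."
Transcription (module docstring): for a weakly divergence-free `u₀ ∈ L³(ℝ³)` represented by
`g ∈ Ḣ^{1/2}` with `T_max(u₀) = katoMaximalTime 1 u₀ < ∞` (unit viscosity, no force), every Kato
solution `u` on `[0, T_max(u₀))` (the mild solution on its maximal interval; it exists and is
unique a.e., `exists_isKatoSolutionOn_katoMaximalTime`, `kato_unique`) has a singular point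
`(T_max, x_*)`: `u` is essentially unbounded on every backward parabolic cylinder
`Q_r(T_max, x_*) = (T_max - r², T_max) × B_r(x_*)`. Refines `rusin_sverak_singular_point_of_blowup`
(same statement with an anonymous lifespan `T > 0`), which it implies given `kato_local` and
`kato_unique` (`rusin_sverak_singular_point_of_blowup_of_singularity_at_katoMaximalTime`). Users
take `(h : rusin_sverak_singularity_at_katoMaximalTime)`.
[cite: RusinSverak2011, §4 pp. 6–7 (paragraph after Thm. 4.1) with §3 (3.14), Prop. 4.1, Thm. 4.1, Prop. 2.1 (arXiv:0911.0500)] -/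
def rusin_sverak_singularity_at_katoMaximalTime : Prop :=
  ∀ (u₀ : ℝ³ → ℝ³) (g : FunctionSpaces.HomSobolev ℝ³ ℂ³ (1 / 2 : ℝ)),
    MemLp u₀ 3 volume → g.Represents (FunctionSpaces.EuclideanSpace.complexify ∘ u₀) →
    IsWeaklyDivFree u₀ → katoMaximalTime 1 u₀ < ⊤ →
    ∀ u : ℝ → ℝ³ → ℝ³, IsKatoSolutionOn (katoMaximalTime 1 u₀).toReal 1 u₀ u →
      ∃ xs : ℝ³, ∀ r : ℝ, 0 < r →
        eLpNorm (uncurry u) ∞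
          (volume.restrict (parabolicCylinder r ((katoMaximalTime 1 u₀).toReal, xs))) = ∞

/-- **`N` from `N′` and Kato's local theory.** For an `Ḣ^{1/2}` datum without global Kato
solution: `T_max(u₀) > 0` (`kato_local`, `katoMaximalTime_pos`), `T_max(u₀) < ∞`
(`katoMaximalTime_eq_top_iff`, by `kato_unique`), the maximal Kato solution on `[0, T_max)`
exists (`exists_isKatoSolutionOn_katoMaximalTime`, gluing by `kato_unique`), and by `N′` it is
singular at some `(T_max, x_*)`; this is `rusin_sverak_singular_point_of_blowup` with
`T = T_max(u₀)` — exactly the printed argument's "Let us assume that `T = T_max(u₀)` is finite".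
[cite: RusinSverak2011, §4 pp. 6–7 (arXiv:0911.0500)] -/
theorem rusin_sverak_singular_point_of_blowup_of_singularity_at_katoMaximalTime
    (hS : rusin_sverak_singularity_at_katoMaximalTime) (hL : kato_local) (hU : kato_unique) :
    rusin_sverak_singular_point_of_blowup := by
  intro u₀ g hu₀ hg hdiv hnot
  have h0 : 0 < katoMaximalTime 1 u₀ := katoMaximalTime_pos hL one_pos hu₀ hdiv
  have htop : katoMaximalTime 1 u₀ < ⊤ :=
    lt_top_iff_ne_top.2 fun h => hnot ((katoMaximalTime_eq_top_iff hU one_pos).1 h)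
  obtain ⟨u, hu⟩ := exists_isKatoSolutionOn_katoMaximalTime hU one_pos h0 htop
  obtain ⟨xs, hxs⟩ := hS u₀ g hu₀ hg hdiv htop u hu
  exact ⟨_, ENNReal.toReal_pos h0.ne' htop.ne, xs, u, hu.mild, hu.continuousInLpOn, hu.initial,
    hu.aestronglyMeasurable, hxs⟩

/-- **Rusin–Šverák, Cor. 4.3, second clause** (`rusin_sverak_minimal_data_compact`: the set of
`Ḣ^{1/2}`-minimal blow-up data is compact modulo scalings and translations) **from `N′`, Cor. 4.2
and Kato's local theory**: `rusin_sverak_minimal_data_compact_of_singular_points'` with `N`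
supplied by `rusin_sverak_singular_point_of_blowup_of_singularity_at_katoMaximalTime`.
[cite: RusinSverak2011, Cor. 4.3 (arXiv:0911.0500 p. 8)] -/
theorem rusin_sverak_minimal_data_compact_of_singularity_at_katoMaximalTime
    (hS : rusin_sverak_singularity_at_katoMaximalTime) (hC : rusin_sverak_weak_limit_of_singular_points)
    (hL : kato_local) (hU : kato_unique) : rusin_sverak_minimal_data_compact :=
  rusin_sverak_minimal_data_compact_of_singular_points'
    (rusin_sverak_singular_point_of_blowup_of_singularity_at_katoMaximalTime hS hL hU) hC

/-- **Rusin–Šverák, Cor. 4.3, first clause** (`rusin_sverak_minimal_blowup`, ns.S14: the set `M`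
of minimal blow-up data is non-empty when `ρ_max < ∞`) **from `N′`, Cor. 4.2 and Kato's local
theory**: `rusin_sverak_minimal_blowup_of_singular_points'` with `N` supplied by
`rusin_sverak_singular_point_of_blowup_of_singularity_at_katoMaximalTime`.
[cite: RusinSverak2011, Cor. 4.3 (arXiv:0911.0500 p. 8)] -/
theorem rusin_sverak_minimal_blowup_of_singularity_at_katoMaximalTime
    (hS : rusin_sverak_singularity_at_katoMaximalTime) (hC : rusin_sverak_weak_limit_of_singular_points)
    (hL : kato_local) (hU : kato_unique) : rusin_sverak_minimal_blowup :=
  rusin_sverak_minimal_blowup_of_singular_points'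
    (rusin_sverak_singular_point_of_blowup_of_singularity_at_katoMaximalTime hS hL hU) hC

end Literature.Analysis.FluidPDE
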